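import Summits.BirchSwinnertonDyer.BirchSwinnertonDyer.Theorems.ByReductionTypeAtTwoSupersingularTwoAdicImageCriterion
import Summits.BirchSwinnertonDyer.BirchSwinnertonDyer.Theorems.ByReductionTypeAtTwoSupersingularCMTraceZeroAtTwo
import HarnessLib

/-!
# D-imc-81 — WHERE KATO'S `2`-ADIC ERROR TERM SITS on crux `SupersingularRankZeroAtTwo` (item 19097, K4):
# (A) the `τ`-OBSTRUCTION AT LEVEL `4` on the non-surjective locus, (B) `a₂ = ±2 ⟹ ρ_{E,2^∞}` ONTO (uniform)

Crux workfile for `stmt-BirchSwinnertonDyer-19097` (cell `bsd-f1-sign2`, planner seat `-imc` g30, LENS = Iwasawa main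
conjecture at `2`; MEMO-imc §10.113).  THEOREMS ONLY (kernel-checked, no `sorry`, no new definition of mathematical content,
no named fact, no instance); closes no item; BSD is NOT proved by any of this.

## Context (the line `Lines/odd_blind_package.lean` v2.8, stub 3 `MuFlatOfNonSurjAtTwo`)
Stub 3 of the line asks for `μ(L♭) = 0`-type input on the NON-surjective locus `¬ TwoAdicSurjective W` of the crux
(`GoodSS W 2`, rank `0`, non-CM).  By the tree's criterion (`SSTwoAdicImage.twoAdicSurjective_iff_forall_j_ne_of_goodSS_two`)
that locus is EXACTLY the Dokchitser–Dokchitser family `j = −4t³(t + 8)`, on which `Im ρ̄_{E,4}` is conjugate into the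
index-`4` subgroup `ℍ ⊂ GL₂(ℤ/4)` (`GL2Mod4.HH`, the normaliser of the non-split Cartan).

## (A) The `τ`-obstruction (§1–§3)
Kato's Euler-system divisibility `char X ∣ L_p` (K. Kato, Astérisque 295 (2004), Thm 17.4 via Thm 13.4(3) / 12.5(4)) is run
under the Euler-system axiom of [Rubin, *Euler systems*, Hyp(ℚ_∞, T)(i)] = Kato Thm 13.4 (3) verbatim: «there exists
`σ ∈ Gal(ℚ̄/ℚ(ζ_{p^∞}))` such that `T/(1 − σ)T` is a free `O`-module of rank one» — SEPARATELY from its clause «Assume further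
`p ≠ 2`».  For `T = T₂E ≅ ℤ₂²`: `T/(σ − 1)T ≅ ℤ₂` iff `det(ρ(σ) − 1) = 0` and `ρ(σ) ≢ 1 (mod 2)` (Smith normal form over
`ℤ₂`); with `det ρ(σ) = χ_cyc(σ) = 1` the first is `tr ρ(σ) = 2`.  Reducing mod `4`: such a `σ` forces an element
`g ∈ Im ρ̄_{E,4}` with `det g = 1`, `tr g = 2`, `g ≢ 1 (mod 2)`.  §1 (`decide`): `ℍ` has NO such element
(`HH_par_eq_one_of_det_eq_one_of_trace_eq_two`), nor has D–D's other exceptional group `H₋₁ = {g : sgn(ḡ) = χ₋₁(det g)}`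
(`Hneg_par_eq_one_of_det_eq_one_of_trace_eq_two`), while `GL₂(ℤ/4)` has `(1 1; 0 1)`.  §2: `det`, `tr`, `≡ 1 (mod 2)` are
conjugation invariants.  §3 ★ `par_rhoMod4_eq_one_of_det_eq_one_of_trace_eq_two`: for `W` good supersingular at `2` with
`¬ TwoAdicSurjective W`, EVERY `σ ∈ Γ_ℚ` with `det ρ̄₄(σ) = 1`, `tr ρ̄₄(σ) = 2` has `ρ̄₄(σ) ≡ 1 (mod 2)`; and the DICHOTOMY
★ `twoAdicSurjective_iff_exists_rubinShape_mod_four`: at a good supersingular `2`, `ρ_{E,2^∞}` is onto **iff** `Im ρ̄_{E,4}`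
contains an element of RUBIN SHAPE (`det = 1`, `tr = 2`, `≢ 1 mod 2`).  CONSEQUENCE (informal, MEMO §10.113): on the whole
non-surjective locus of the crux Rubin's Hyp(ℚ_∞,T₂E)(i) FAILS — Kato's `2`-adic error term for stub 3 sits on the Euler-system
AXIOM (no `τ`), not merely on the excluded prime; a `μ`-input for `X♭` there must be non-Euler-systemic (layer certificate
§10.28 (A)(B)(C), per curve).  (Hyp(ℚ_∞, V)(i) — the rational version — holds for every open image.)

## (B) `a₂ ≠ 0 ⟹ TwoAdicSurjective` (§4), UNIFORM over all `E/ℚ` good supersingular at `2`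
`GoodSS W 2 ⟹ 16 ∣ c₄(E_min)` and `Δ_min` odd, so `v₂(j) = 3·v₂(c₄) ≥ 12`, and `a₂ ≠ 0 ⟺ 32 ∤ c₄ ⟺ v₂(j) = 12`
(tree: `ThetaPartnerXRoute.frobeniusTrace_two_ne_zero_iff_not_dvd_c₄`); but `v₂(−4t³(t + 8)) ∈ {2 + 4v (v ≤ 2)} ∪ {≥ 14}`
is never `12` (`padicValRat_two_dd_ne_twelve`).  Hence ★ `twoAdicSurjective_of_goodSS_two_of_frobeniusTrace_two_ne_zero`:
the `549` per-class `a₂ = ±2` surjectivity certificates of the cell `bsd-2adic` are ONE theorem, and the non-surjective branch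
of the crux lies inside the `a₂ = 0` row (census MEMO-imc-data/dimc81: Cremona `N < 5·10⁵`: `304` D–D classes, all `a₂ = 0`,
ranks `117/161/26`; X5 rank-`0`: exactly `107217l`, `184041bk`).

References: [KatoAsterisque2004] K. Kato, Astérisque 295 (2004), Thm 12.5(4), Thm 13.4(3), §17.4;
[RubinEulerSystems2000] K. Rubin, *Euler Systems*, Ann. Math. Studies 147, §2.1 Hyp(K_∞,T), Thm 2.3.3;
[DokchitserDokchitserMathZ2012] Theorem (2) and Lemma; [SilvermanAEC2009] III.§1, VII.1.
-/

set_option autoImplicit false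
set_option linter.dupNamespace false

noncomputable section

open scoped Classical

open Matrix WeierstrassCurve Literature.NumberTheory.EllipticCurves Literature.NumberTheory.EllipticCurves.Rank1Residual
open Literature.NumberTheory.GaloisRepresentations.GL2Mod4
open Literature.NumberTheory.GaloisRepresentations.GL2Mod8 (P4 P4.mul eps)
open Literature.NumberTheory.EllipticCurves.DokchitserDokchitser2012
open Summit.BirchSwinnertonDyer.Rank1Residual Summit.BirchSwinnertonDyer.Rank1Residual.X5.O1
open Summit.BirchSwinnertonDyer.BirchSwinnertonDyer.Theorems

namespace Summit.BirchSwinnertonDyer.BirchSwinnertonDyer.Cruxes.SupersingularRankZeroAtTwo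

namespace D81TauObstructionAtTwo

/-! ## §1 `GL₂(ℤ/4ℤ)`: no element of Rubin shape in `ℍ` or in `H₋₁`; one in `GL₂(ℤ/4ℤ)` -/

set_option maxRecDepth 100000 in
set_option maxHeartbeats 0 in
/-- **In `ℍ`, `det h = 1 ∧ tr h = 2 ⟹ h ≡ 1 (mod 2)`** (the `12` elements of `ℍ ∩ SL₂(ℤ/4)` of trace `2` are
`±1, ±(1 + 2w₀)`-type kernel elements). [cite: DokchitserDokchitserMathZ2012, proof of Theorem (2) (the subgroup ℍ)] -/
theorem HH_par_eq_one_of_det_eq_one_of_trace_eq_two :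
    ∀ h ∈ HH, Q4.det h = 1 → h.1 + h.2.2.2 = 2 → Q4.par h = (1, 0, 0, 1) := by
  decide +kernel

set_option maxRecDepth 100000 in
set_option maxHeartbeats 0 in
/-- **In `H₋₁ = {g ∈ GL₂(ℤ/4) : sgn ḡ = χ₋₁(det g)}`** (D–D's exceptional group for `Δ ∈ −ℚ^{×2}`, index `2`),
**`det g = 1 ∧ tr g = 2 ⟹ g ≡ 1 (mod 2)`** (`det g = 1` forces `ḡ ∈ A₃`, and `tr ḡ = 0` kills the `3`-cycles).
[cite: DokchitserDokchitserMathZ2012, proof of Theorem (2) (the index-2 subgroups)] -/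
theorem Hneg_par_eq_one_of_det_eq_one_of_trace_eq_two :
    ∀ g : Q4, Q4.det g * Q4.det g = 1 → (eps (Q4.par g) = 0 ↔ Q4.det g = 1) → Q4.det g = 1 →
      g.1 + g.2.2.2 = 2 → Q4.par g = (1, 0, 0, 1) := by
  decide +kernel

/-- **`GL₂(ℤ/4ℤ)` itself has an element of Rubin shape**: `(1 1; 0 1)` has `det = 1`, `tr = 2`, `≢ 1 (mod 2)`
(it is `ρ(τ)` for Rubin's `τ` when `ρ_{E,2^∞}` is onto). [folklore] -/
theorem rubinShape_one_one_zero_one :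
    Q4.det ((1, 1, 0, 1) : Q4) = 1 ∧ ((1 : ZMod 4) + 1 = 2) ∧ Q4.par ((1, 1, 0, 1) : Q4) ≠ (1, 0, 0, 1) := by
  decide

/-! ## §2 `det`, `tr` and `≡ 1 (mod 2)` are conjugation invariants in `M₂(ℤ/4ℤ)` -/

/-- `P4.mul p 1̄ = p`. [folklore] -/
theorem P4_mul_one : ∀ p : P4, P4.mul p (1, 0, 0, 1) = p := by decide

/-- `det (k m k⁻¹) = det m` for `det k ∈ (ℤ/4)^×`. [folklore] -/
theorem det_conj (k m : M4) (hk : k.det * k.det = 1) : (k * m * inv' k).det = m.det := by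
  have e : k.det * (inv' k).det = 1 := by rw [← Matrix.det_mul, mul_inv' hk, Matrix.det_one]
  rw [Matrix.det_mul, Matrix.det_mul]
  linear_combination m.det * e

/-- `tr (k m k⁻¹) = tr m` for `det k ∈ (ℤ/4)^×`. [folklore] -/
theorem trace_conj (k m : M4) (hk : k.det * k.det = 1) : (k * m * inv' k).trace = m.trace := by
  rw [Matrix.trace_mul_cycle, inv'_mul hk, one_mul]

/-- `k m k⁻¹ ≡ 1 (mod 2) ⟹ m ≡ 1 (mod 2)` for `det k ∈ (ℤ/4)^×`. [folklore] -/
theorem par_eq_one_of_par_conj_eq_one (k m : M4) (hk : k.det * k.det = 1)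
    (h : par (k * m * inv' k) = (1, 0, 0, 1)) : par m = (1, 0, 0, 1) := by
  have e : m = inv' k * (k * m * inv' k) * k := by
    rw [← mul_assoc, ← mul_assoc, inv'_mul hk, one_mul, mul_assoc, inv'_mul hk, mul_one]
  rw [e, par_mul, par_mul, h, P4_mul_one, ← par_mul, inv'_mul hk, par_one]

/-- `tr g = (tup g).1 + (tup g).2.2.2`. [folklore] -/
theorem trace_eq_tup (g : M4) : g.trace = (tup g).1 + (tup g).2.2.2 := by
  rw [Matrix.trace_fin_two]; rfl

/-! ## §3 Curve level: the `τ`-obstruction on the non-surjective locus of a good supersingular `2` -/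

/-- `-1` is not a square in `ℚ`. [folklore] -/
private theorem not_isSquare_neg_one_rat : ¬ IsSquare (-1 : ℚ) := by
  rintro ⟨r, hr⟩
  nlinarith [mul_self_nonneg r]

variable (W : WeierstrassCurve ℚ) [W.IsElliptic] [W.IsGloballyMinimal]

/-- **Non-surjective at a good supersingular `2` ⟹ `Im ρ̄_{E,4}` is conjugate into `ℍ`** (tree: the non-surjective
branch is the D–D family `exists_j_eq_of_not_twoAdicSurjective_of_goodSS_two`, and D–D's Lemma (3) ⟹ (1)
`LevelFour.conj_subset_HH_iff_exists_j_eq`, whose hypotheses `ρ̄₂` onto / `−Δ ∉ ℚ^{×2}` hold at a good supersingular `2`).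
[cite: DokchitserDokchitserMathZ2012, Theorem (2) and Lemma (p. 962)] -/
theorem exists_conj_subset_HH_of_not_twoAdicSurjective (h : GoodSS W 2) (hns : ¬ TwoAdicSurjective W) :
    ∃ k : M4, k.det * k.det = 1 ∧
      ∀ σ : Field.absoluteGaloisGroup ℚ, tup (k * LevelFour.M W two_ne_zero σ * inv' k) ∈ HH := by
  haveI : PerfectField ℚ := PerfectField.ofCharZero
  exact (LevelFour.conj_subset_HH_iff_exists_j_eq W two_ne_zero (by norm_num) not_isSquare_neg_one_rat
    (SSTwoAdicImage.hasSurjectiveModNGaloisRep_two_of_goodSS_two W h)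
    (SSTwoAdicImage.not_isSquare_neg_Δ_of_goodSS_two W h)).mpr
    (SSTwoAdicImage.exists_j_eq_of_not_twoAdicSurjective_of_goodSS_two W h hns)

/-- ★ **THE `τ`-OBSTRUCTION AT LEVEL `4`.** For `E/ℚ` good supersingular at `2` with `ρ_{E,2^∞}` NOT onto:
every `σ ∈ Γ_ℚ` with `det ρ̄_{E,4}(σ) = 1` and `tr ρ̄_{E,4}(σ) = 2` has `ρ̄_{E,4}(σ) ≡ 1 (mod 2)`.  In particular no
`σ ∈ Gal(ℚ̄/ℚ(ζ_{2^∞}))` has `T₂E/(σ − 1)T₂E` free of rank one: Rubin's Hyp(ℚ_∞, T₂E)(i) = the `τ` of Kato's Thm 13.4(3)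
fails on the whole non-surjective locus of the crux. [cite: KatoAsterisque2004, Thm 13.4 (3)]
[cite: DokchitserDokchitserMathZ2012, Theorem (2)] -/
theorem par_rhoMod4_eq_one_of_det_eq_one_of_trace_eq_two (h : GoodSS W 2) (hns : ¬ TwoAdicSurjective W)
    (σ : Field.absoluteGaloisGroup ℚ) (hdet : (LevelFour.M W two_ne_zero σ).det = 1)
    (htr : (LevelFour.M W two_ne_zero σ).trace = 2) :
    par (LevelFour.M W two_ne_zero σ) = (1, 0, 0, 1) := by
  obtain ⟨k, hk, hH⟩ := exists_conj_subset_HH_of_not_twoAdicSurjective W h hns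
  have hmem := hH σ
  have hdet' : Q4.det (tup (k * LevelFour.M W two_ne_zero σ * inv' k)) = 1 := by
    rw [← det_eq, det_conj _ _ hk, hdet]
  have htr' : (tup (k * LevelFour.M W two_ne_zero σ * inv' k)).1 +
      (tup (k * LevelFour.M W two_ne_zero σ * inv' k)).2.2.2 = 2 := by
    rw [← trace_eq_tup, trace_conj _ _ hk, htr]
  exact par_eq_one_of_par_conj_eq_one k _ hk
    (HH_par_eq_one_of_det_eq_one_of_trace_eq_two _ hmem hdet' htr')

/-- **No element of Rubin shape in `Im ρ̄_{E,4}`** on the non-surjective locus (restatement).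
[cite: KatoAsterisque2004, Thm 13.4 (3)] [cite: DokchitserDokchitserMathZ2012, Theorem (2)] -/
theorem not_exists_rubinShape_of_not_twoAdicSurjective (h : GoodSS W 2) (hns : ¬ TwoAdicSurjective W) :
    ¬ ∃ σ : Field.absoluteGaloisGroup ℚ, (LevelFour.M W two_ne_zero σ).det = 1 ∧
      (LevelFour.M W two_ne_zero σ).trace = 2 ∧ par (LevelFour.M W two_ne_zero σ) ≠ (1, 0, 0, 1) :=
  fun ⟨σ, hdet, htr, hpar⟩ ↦ hpar (par_rhoMod4_eq_one_of_det_eq_one_of_trace_eq_two W h hns σ hdet htr)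

omit [W.IsGloballyMinimal] in
/-- **Surjective ⟹ an element of Rubin shape**: `(1 1; 0 1) = ρ̄_{E,4}(σ)` for some `σ`. [folklore] -/
theorem exists_rubinShape_of_twoAdicSurjective (him : TwoAdicSurjective W) :
    ∃ σ : Field.absoluteGaloisGroup ℚ, (LevelFour.M W two_ne_zero σ).det = 1 ∧
      (LevelFour.M W two_ne_zero σ).trace = 2 ∧ par (LevelFour.M W two_ne_zero σ) ≠ (1, 0, 0, 1) := by
  obtain ⟨σ, hσ⟩ := (hasSurjectiveModNGaloisRep_iff_matrix W (LevelFour.frame4 W two_ne_zero)).mp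
    (SSTwoAdicImage.hasSurjectiveModNGaloisRep_four_of_twoAdicSurjective W him) !![1, 1; 0, 1] ⟨1, by decide⟩
  refine ⟨σ, ?_, ?_, ?_⟩
  · rw [show LevelFour.M W two_ne_zero σ = !![1, 1; 0, 1] from hσ]; decide
  · rw [show LevelFour.M W two_ne_zero σ = !![1, 1; 0, 1] from hσ]; decide
  · rw [show LevelFour.M W two_ne_zero σ = !![1, 1; 0, 1] from hσ]; decide

/-- ★ **DICHOTOMY AT LEVEL `4`.** At a good supersingular `2`: `ρ_{E,2^∞}` is onto `GL₂(ℤ₂)` **iff** `Im ρ̄_{E,4}`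
contains an element of Rubin shape (`det = 1`, `tr = 2`, `≢ 1 (mod 2)`) — i.e. iff the mod-`4` shadow of Rubin's
Hyp(ℚ_∞, T₂E)(i) holds. [cite: KatoAsterisque2004, Thm 13.4 (3)] [cite: DokchitserDokchitserMathZ2012, Theorem (2)] -/
theorem twoAdicSurjective_iff_exists_rubinShape_mod_four (h : GoodSS W 2) :
    TwoAdicSurjective W ↔ ∃ σ : Field.absoluteGaloisGroup ℚ, (LevelFour.M W two_ne_zero σ).det = 1 ∧
      (LevelFour.M W two_ne_zero σ).trace = 2 ∧ par (LevelFour.M W two_ne_zero σ) ≠ (1, 0, 0, 1) :=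
  ⟨exists_rubinShape_of_twoAdicSurjective W, fun hex ↦ by
    by_contra hns
    exact not_exists_rubinShape_of_not_twoAdicSurjective W h hns hex⟩

/-! ## §4 `a₂ ≠ 0 ⟹ ρ_{E,2^∞}` onto, uniformly -/

/-- **`v₂(−4t³(t + 8)) ≠ 12` for `t ∈ ℚ ∖ {0, −8}`**: with `v = v₂(t)`, the valuation is `2 + 4v` for `v ≤ 2`,
`≥ 14` for `v = 3`, and `5 + 3v ≥ 17` for `v ≥ 4`. [folklore] -/
theorem padicValRat_two_dd_ne_twelve (t : ℚ) (ht0 : t ≠ 0) (ht8 : t + 8 ≠ 0) :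
    padicValRat 2 (-4 * t ^ 3 * (t + 8)) ≠ 12 := by
  have h4 : padicValRat 2 (-4 : ℚ) = 2 := by
    rw [padicValRat.neg, show (4 : ℚ) = ((2 ^ 2 : ℕ) : ℚ) by norm_num, padicValRat.of_nat,
      padicValNat.prime_pow]
    rfl
  have h8 : padicValRat 2 (8 : ℚ) = 3 := by
    rw [show (8 : ℚ) = ((2 ^ 3 : ℕ) : ℚ) by norm_num, padicValRat.of_nat, padicValNat.prime_pow]
    rfl
  have ht3 : padicValRat 2 (t ^ 3) = 3 * padicValRat 2 t := by
    rw [padicValRat.pow]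
    rfl
  have hne1 : (-4 : ℚ) * t ^ 3 ≠ 0 := mul_ne_zero (by norm_num) (pow_ne_zero 3 ht0)
  rw [padicValRat.mul hne1 ht8, padicValRat.mul (by norm_num) (pow_ne_zero 3 ht0), h4, ht3]
  by_cases h3 : padicValRat 2 t = 3
  · have hmin := padicValRat.min_le_padicValRat_add (p := 2) ht8
    rw [h3, h8, min_self] at hmin
    omega
  · have hmin := padicValRat.add_eq_min ht8 ht0 (by norm_num) (by rw [h8]; exact h3)
    rw [h8] at hmin
    rcases lt_or_gt_of_ne h3 with hlt | hgt
    · rw [min_eq_left hlt.le] at hmin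
      omega
    · rw [min_eq_right hgt.le] at hmin
      omega

/-- ★ **`a₂(E) ≠ 0` at a good supersingular `2 ⟹ ρ_{E,2^∞}` is onto `GL₂(ℤ₂)`**, for EVERY `E/ℚ`
(`16 ∣ c₄(E_min)`, `32 ∤ c₄(E_min)`, `Δ_min` odd give `v₂(j) = 12`; an exceptional `j = −4t³(t + 8)` never has
`v₂ = 12`; conclude by the tree's criterion `twoAdicSurjective_iff_forall_j_ne_of_goodSS_two`).
[cite: DokchitserDokchitserMathZ2012, Theorem (2)] [cite: SilvermanAEC2009, III.§1 and VII.1] -/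
theorem twoAdicSurjective_of_goodSS_two_of_frobeniusTrace_two_ne_zero (h : GoodSS W 2)
    (ha : W.frobeniusTrace 2 ≠ 0) : TwoAdicSurjective W := by
  rw [SSTwoAdicImage.twoAdicSurjective_iff_forall_j_ne_of_goodSS_two W h]
  intro t ht
  have h32 : ¬ (32 : ℤ) ∣ (integralModelInt W).c₄ :=
    (ThetaPartnerXRoute.frobeniusTrace_two_ne_zero_iff_not_dvd_c₄ W h).mp ha
  obtain ⟨h1, h3⟩ := Supersingular.even_a₁_and_odd_a₃_of_goodSS_two W h.1 h.2
  set M := integralModelInt W with hM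
  have h16 : (16 : ℤ) ∣ M.c₄ := sixteen_dvd_c₄_of_even_a₁ M h1
  obtain ⟨m, hm⟩ := ThetaPartnerXRoute.odd_Δ_of_even_a₁_odd_a₃ M h1 h3
  have hc0 : M.c₄ ≠ 0 := fun h0 ↦ h32 (by rw [h0]; exact dvd_zero 32)
  have hΔ0 : M.Δ ≠ 0 := by omega
  -- the equation `c₄³ = j · Δ = −4t³(t+8) · Δ` in `ℚ`
  have hc₄ : (M.c₄ : ℚ) = W.c₄ := by
    have hh := M.map_c₄ (Int.castRingHom ℚ)
    rw [hM, map_integralModelInt, eq_intCast] at hh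
    exact hh.symm
  have hΔ : (M.Δ : ℚ) = W.Δ := cast_minimalDiscriminantInt W
  have key : ((M.c₄ : ℚ)) ^ 3 = -4 * t ^ 3 * (t + 8) * (M.Δ : ℚ) := by
    rw [hc₄, hΔ, ← ht]
    exact (X12.j_mul_Δ_eq_c₄_pow W).symm
  -- `t ≠ 0`, `t + 8 ≠ 0` (else `c₄ = 0`)
  have hc0Q : (M.c₄ : ℚ) ≠ 0 := by exact_mod_cast hc0
  have hΔ0Q : (M.Δ : ℚ) ≠ 0 := by exact_mod_cast hΔ0
  have hprod : -4 * t ^ 3 * (t + 8) ≠ 0 := by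
    intro h0
    rw [h0, zero_mul] at key
    exact pow_ne_zero 3 hc0Q key
  have ht0 : t ≠ 0 := by
    rintro rfl
    exact hprod (by ring)
  have ht8 : t + 8 ≠ 0 := by
    intro h0
    exact hprod (by rw [h0, mul_zero])
  -- valuations: `v₂(c₄) = 4`, `v₂(Δ) = 0`
  have hv4 : padicValInt 2 M.c₄ = 4 := by
    have hle : 4 ≤ padicValInt 2 M.c₄ := by
      rcases (padicValInt_dvd_iff (p := 2) 4 M.c₄).mp (by norm_num; exact h16) with h0 | hle
      · exact absurd h0 hc0
      · exact hle
    have hlt : ¬ 5 ≤ padicValInt 2 M.c₄ := fun h5 ↦ h32 (by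
      have hd := (padicValInt_dvd_iff (p := 2) 5 M.c₄).mpr (Or.inr h5)
      norm_num at hd
      exact hd)
    omega
  have hvΔ : padicValInt 2 M.Δ = 0 :=
    padicValInt.eq_zero_of_not_dvd (by rw [hm]; omega)
  have hL : padicValRat 2 (((M.c₄ : ℚ)) ^ 3) = 12 := by
    rw [padicValRat.pow, padicValRat.of_int, hv4]
    rfl
  have hR : padicValRat 2 (-4 * t ^ 3 * (t + 8) * (M.Δ : ℚ)) = padicValRat 2 (-4 * t ^ 3 * (t + 8)) := by
    rw [padicValRat.mul hprod hΔ0Q, padicValRat.of_int, hvΔ]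
    simp
  have : padicValRat 2 (-4 * t ^ 3 * (t + 8)) = 12 := by rw [← hR, ← key, hL]
  exact padicValRat_two_dd_ne_twelve t ht0 ht8 this

/-- **Contrapositive: a non-surjective curve of the crux has `a₂ = 0`** — the non-surjective branch of stub 3
(`MuFlatOfNonSurjAtTwo`) lies inside the `a₂ = 0` row. [cite: DokchitserDokchitserMathZ2012, Theorem (2)] -/
theorem frobeniusTrace_two_eq_zero_of_not_twoAdicSurjective (h : GoodSS W 2) (hns : ¬ TwoAdicSurjective W) :
    W.frobeniusTrace 2 = 0 := by
  by_contra ha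
  exact hns (twoAdicSurjective_of_goodSS_two_of_frobeniusTrace_two_ne_zero W h ha)

end D81TauObstructionAtTwo

end Summit.BirchSwinnertonDyer.BirchSwinnertonDyer.Cruxes.SupersingularRankZeroAtTwo
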